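import Summits.ResolutionOfSingularities.ResolutionOfSingularities.Theorems.RadicialJungCleanModelsCcurvePersistPrelims
import Summits.ResolutionOfSingularities.ResolutionOfSingularities.Theorems.FrobeniusClosingSteerShannonCoarseningLemmas
import HarnessLib

/-!
# Route `RadicialJung`, crux `CleanModels` (stmt-15917) — (C-curve) sub-line: the conormal lemma at the local ring of the centre curve

Lead `res-B-lead-1` g7 (plan `Cruxes/CleanModels/Lines/Sketch-memo-Ccurve-plan.md` §1 S5; workfile `Lines/Sketch_Ccurve_assembly.lean` v2.8, stubs
`stub_Cc_persistForm1/3`).  OURS · counted 0.  Nothing here proves resolution in characteristic `p`; resolution in char `p` is NOT proved.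

Setting: `S' = locAtCentre B' O` with regular system of parameters `(x, y, z)`, `O ≤ O₁`, and the curve characterisation `hcen` (`v₁ w < 1 ↔ w ∈ (x, y)`,
i.e. `(x, y)` is the centre of `O₁` on `S'`); `S₁ = locAtCentre B' O₁ ⊇ S'` is the (2-dimensional regular) local ring at the generic point of the centre curve.
* `le_locAtCentre_coarse` — `S' ≤ S₁`;
* `exists_numerator_of_valuation_lt` — an element of `S₁` of `v₁`-value `< 1` is `(x α + y β) / γ` with `α, β ∈ S'`, `γ ∈ B'`, `v₁ γ = 1`;
* `maximalIdeal_coarse_eq_span_pair` — `𝔪_{S₁} = (x, y) S₁`;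
* `ne_mul_of_coarse` — `x ≠ c · y` and `y ≠ c · x` for `c ∈ S₁` (`x, y` is a minimal basis of `𝔪_{S₁}`, `dim S₁ = 2`);
* `conormal_det` — **the conormal lemma**: if `t₀ = (x α₀ + y β₀)/γ₀`, `t₁ = (x α₁ + y β₁)/γ₁` generate `𝔪_{S₁}`, then `v₁ (α₀ β₁ − α₁ β₀) = 1`
  (the conormal matrix of the two divisors along the curve is invertible at the generic point);
* `transversal_of_not_mem_sq` — if `(x α + y β)/γ ∉ 𝔪_{S₁}²` then `v₁ α = 1 ∨ v₁ β = 1`.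
-/

noncomputable section

set_option linter.dupNamespace false

open IsLocalRing Literature.AlgebraicGeometry.Resolution
open Summit.ResolutionOfSingularities.ResolutionOfSingularities.Theorems
open Summit.ResolutionOfSingularities.ResolutionOfSingularities.Theorems.SwitchingDichotomy

namespace Summit.ResolutionOfSingularities.ResolutionOfSingularities.Theorems.RadicialJung.CleanModels.Ccurve

variable {K : Type} [Field K]

/-- `locAtCentre B' O ≤ locAtCentre B' O₁` for a coarsening `O ≤ O₁`. [folklore] -/
theorem le_locAtCentre_coarse {B' : Subring K} {O O₁ : ValuationSubring K} (hOO₁ : O ≤ O₁) :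
    locAtCentre B' O ≤ locAtCentre B' O₁ := by
  rintro v ⟨y₁, hy₁, z₁, hz₁, hvz₁, rfl⟩
  exact ⟨y₁, hy₁, z₁, hz₁, Shannon.valuation_eq_one_of_le hOO₁ hvz₁, rfl⟩

section setting

variable {B' : Subring K} {O O₁ : ValuationSubring K} (hB'O : B' ≤ O.toSubring) (hOO₁ : O ≤ O₁)
  {x y : K} (hx : x ∈ locAtCentre B' O) (hy : y ∈ locAtCentre B' O)
  (hcen : ∀ w : ↥(locAtCentre B' O), O₁.valuation (w : K) < 1 ↔ w ∈ Ideal.span ({⟨x, hx⟩, ⟨y, hy⟩} : Set ↥(locAtCentre B' O)))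

include hcen in
/-- An element of `S₁ = locAtCentre B' O₁` of `v₁`-value `< 1` is `(x α + y β) / γ` with `α, β ∈ S' = locAtCentre B' O`, `γ ∈ B'`, `v₁ γ = 1`. [folklore] -/
theorem exists_numerator_of_valuation_lt {t : K} (ht : t ∈ locAtCentre B' O₁) (hvt : O₁.valuation t < 1) :
    ∃ α β γ : K, α ∈ locAtCentre B' O ∧ β ∈ locAtCentre B' O ∧ γ ∈ B' ∧ O₁.valuation γ = 1 ∧ t = (x * α + y * β) / γ := by
  obtain ⟨num, hnum, den, hden, hvden, rfl⟩ := mem_locAtCentre_iff.mp ht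
  have hvnum : O₁.valuation num < 1 := by
    rw [map_div₀, hvden, div_one] at hvt; exact hvt
  have hnumS : num ∈ locAtCentre B' O := le_locAtCentre _ _ hnum
  obtain ⟨α, β, hα, hβ, hrel⟩ := (mem_span_pair_iff_exists hnumS hx hy).mp ((hcen ⟨num, hnumS⟩).mp hvnum)
  exact ⟨α, β, den, hα, hβ, hden, hvden, by rw [hrel]⟩

include hB'O hcen in
/-- `𝔪_{S₁} = (x, y) S₁` for `S₁ = locAtCentre B' O₁`. [folklore] -/
theorem maximalIdeal_coarse_eq_span_pair :
    (haveI := isLocalRing_locAtCentre (fun _ hw => hOO₁ (hB'O hw) : B' ≤ O₁.toSubring);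
      IsLocalRing.maximalIdeal ↥(locAtCentre B' O₁)) =
      Ideal.span ({⟨x, le_locAtCentre_coarse hOO₁ hx⟩, ⟨y, le_locAtCentre_coarse hOO₁ hy⟩} : Set ↥(locAtCentre B' O₁)) := by
  have hB'O₁ : B' ≤ O₁.toSubring := fun _ hw => hOO₁ (hB'O hw)
  haveI := isLocalRing_locAtCentre hB'O₁
  apply le_antisymm
  · intro w hw
    have hvw : O₁.valuation (w : K) < 1 := (mem_maximalIdeal_locAtCentre_iff hB'O₁ w).mp hw
    obtain ⟨α, β, γ, hα, hβ, hγ, hvγ, hrel⟩ := exists_numerator_of_valuation_lt hx hy hcen w.2 hvw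
    have hγ0 : γ ≠ 0 := ne_zero_of_valuation_eq_one hvγ
    have hγinv : γ⁻¹ ∈ locAtCentre B' O₁ := inv_mem_locAtCentre (le_locAtCentre _ _ hγ) hvγ
    have hw' : (w : K) ∈ locAtCentre B' O₁ := w.2
    have key : (⟨(w : K), hw'⟩ : ↥(locAtCentre B' O₁)) ∈
        Ideal.span ({⟨x, le_locAtCentre_coarse hOO₁ hx⟩, ⟨y, le_locAtCentre_coarse hOO₁ hy⟩} : Set ↥(locAtCentre B' O₁)) := by
      refine (mem_span_pair_iff_exists hw' _ _).mpr ⟨α * γ⁻¹, β * γ⁻¹,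
        Subring.mul_mem _ (le_locAtCentre_coarse hOO₁ hα) hγinv, Subring.mul_mem _ (le_locAtCentre_coarse hOO₁ hβ) hγinv, ?_⟩
      rw [hrel]; field_simp
    exact key
  · rw [Ideal.span_le]
    intro w hw
    rcases hw with hw | hw
    · rw [hw]
      exact (mem_maximalIdeal_locAtCentre_iff hB'O₁ _).mpr ((hcen ⟨x, hx⟩).mpr (Ideal.subset_span (by simp)))
    · rw [Set.mem_singleton_iff] at hw
      rw [hw]
      exact (mem_maximalIdeal_locAtCentre_iff hB'O₁ _).mpr ((hcen ⟨y, hy⟩).mpr (Ideal.subset_span (by simp)))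

include hB'O hOO₁ hcen in
/-- `x ∉ y · S₁` and `y ∉ x · S₁`: `(x, y)` is a minimal basis of `𝔪_{S₁}` since `S₁` is regular of dimension `2`. [folklore] -/
theorem ne_mul_of_coarse [IsRegularLocalRing ↥(locAtCentre B' O₁)] (hdim₁ : ringKrullDim ↥(locAtCentre B' O₁) = 2)
    {c : K} (hc : c ∈ locAtCentre B' O₁) : x ≠ c * y ∧ y ≠ c * x := by
  classical
  have hB'O₁ : B' ≤ O₁.toSubring := fun _ hw => hOO₁ (hB'O hw)
  haveI := isLocalRing_locAtCentre hB'O₁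
  have hd : (maximalIdeal ↥(locAtCentre B' O₁)).spanFinrank = 2 := by
    have h := (‹IsRegularLocalRing ↥(locAtCentre B' O₁)›).spanFinrank_maximalIdeal
    rw [hdim₁] at h
    exact_mod_cast h
  set x₁ : ↥(locAtCentre B' O₁) := ⟨x, le_locAtCentre_coarse hOO₁ hx⟩ with hx₁
  set y₁ : ↥(locAtCentre B' O₁) := ⟨y, le_locAtCentre_coarse hOO₁ hy⟩ with hy₁
  have hmax := maximalIdeal_coarse_eq_span_pair hB'O hOO₁ hx hy hcen
  have hrange : Ideal.span (Set.range ![x₁, y₁]) = maximalIdeal ↥(locAtCentre B' O₁) := by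
    rw [hmax]; congr 1; ext v; simp only [Set.mem_range, Set.mem_insert_iff, Set.mem_singleton_iff]
    constructor
    · rintro ⟨j, rfl⟩; fin_cases j <;> simp [hx₁, hy₁]
    · rintro (rfl | rfl); exacts [⟨0, rfl⟩, ⟨1, rfl⟩]
  have h0 := not_mem_span_image_of_not_mem hd ![x₁, y₁] hrange (S := ({1} : Set (Fin 2))) (i := 0) (by decide)
  have h1 := not_mem_span_image_of_not_mem hd ![x₁, y₁] hrange (S := ({0} : Set (Fin 2))) (i := 1) (by decide)
  simp only [Set.image_singleton, Matrix.cons_val_one, Matrix.cons_val_zero] at h0 h1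
  constructor
  · intro hxy
    apply h0
    change x₁ ∈ Ideal.span {y₁}
    exact Ideal.mem_span_singleton'.mpr ⟨⟨c, hc⟩, Subtype.ext (by simp [hx₁, hy₁, hxy, mul_comm])⟩
  · intro hyx
    apply h1
    change y₁ ∈ Ideal.span {x₁}
    exact Ideal.mem_span_singleton'.mpr ⟨⟨c, hc⟩, Subtype.ext (by simp [hx₁, hy₁, hyx, mul_comm])⟩

/-- In a linearly ordered commutative group with zero, `a ≤ 1`, `b ≤ 1`, `a * b = 1` force `b = 1`. [folklore] -/
theorem eq_one_of_mul_eq_one_of_le {Γ : Type*} [LinearOrderedCommGroupWithZero Γ] {a b : Γ} (ha : a ≤ 1) (hb : b ≤ 1) (hab : a * b = 1) :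
    b = 1 := by
  by_contra hne
  have hlt : b < 1 := lt_of_le_of_ne hb hne
  have : a * b < 1 := by
    calc a * b ≤ 1 * b := by gcongr
      _ = b := one_mul b
      _ < 1 := hlt
  rw [hab] at this
  exact lt_irrefl _ this

include hB'O hcen in
/-- **The conormal lemma.**  If `t₀ = (x α₀ + y β₀)/γ₀` and `t₁ = (x α₁ + y β₁)/γ₁` (`α_i, β_i, γ_i ∈ S₁`, `γ_i` of `v₁`-value `1`) generate the maximal ideal
of the 2-dimensional regular local ring `S₁ = locAtCentre B' O₁`, then the conormal determinant `α₀ β₁ − α₁ β₀` has `v₁`-value `1` (the conormal matrix of the two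
divisors along the centre curve is invertible at its generic point). [folklore] -/
theorem conormal_det [IsRegularLocalRing ↥(locAtCentre B' O₁)] (hdim₁ : ringKrullDim ↥(locAtCentre B' O₁) = 2)
    {α₀ β₀ γ₀ α₁ β₁ γ₁ : K} (hα₀ : α₀ ∈ locAtCentre B' O₁) (hβ₀ : β₀ ∈ locAtCentre B' O₁) (hγ₀ : γ₀ ∈ locAtCentre B' O₁)
    (hvγ₀ : O₁.valuation γ₀ = 1)
    (hα₁ : α₁ ∈ locAtCentre B' O₁) (hβ₁ : β₁ ∈ locAtCentre B' O₁) (hγ₁ : γ₁ ∈ locAtCentre B' O₁) (hvγ₁ : O₁.valuation γ₁ = 1)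
    (ht₀ : (x * α₀ + y * β₀) / γ₀ ∈ locAtCentre B' O₁) (ht₁ : (x * α₁ + y * β₁) / γ₁ ∈ locAtCentre B' O₁)
    (hgen : (haveI := isLocalRing_locAtCentre (fun _ hw => hOO₁ (hB'O hw) : B' ≤ O₁.toSubring);
      IsLocalRing.maximalIdeal ↥(locAtCentre B' O₁)) = Ideal.span ({⟨_, ht₀⟩, ⟨_, ht₁⟩} : Set ↥(locAtCentre B' O₁))) :
    O₁.valuation (α₀ * β₁ - α₁ * β₀) = 1 := by
  classical
  have hB'O₁ : B' ≤ O₁.toSubring := fun _ hw => hOO₁ (hB'O hw)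
  haveI := isLocalRing_locAtCentre hB'O₁
  have hxS₁ : x ∈ locAtCentre B' O₁ := le_locAtCentre_coarse hOO₁ hx
  have hyS₁ : y ∈ locAtCentre B' O₁ := le_locAtCentre_coarse hOO₁ hy
  have hγ₀0 : γ₀ ≠ 0 := ne_zero_of_valuation_eq_one hvγ₀
  have hγ₁0 : γ₁ ≠ 0 := ne_zero_of_valuation_eq_one hvγ₁
  have hγ₀inv : γ₀⁻¹ ∈ locAtCentre B' O₁ := inv_mem_locAtCentre hγ₀ hvγ₀
  have hγ₁inv : γ₁⁻¹ ∈ locAtCentre B' O₁ := inv_mem_locAtCentre hγ₁ hvγ₁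
  have hle1 : ∀ {w : K}, w ∈ locAtCentre B' O₁ → O₁.valuation w ≤ 1 := fun hw =>
    (O₁.valuation_le_one_iff _).mpr (locAtCentre_le hB'O₁ hw)
  -- `x, y ∈ 𝔪₁ = (t₀, t₁)`
  have hxm : (⟨x, hxS₁⟩ : ↥(locAtCentre B' O₁)) ∈ maximalIdeal ↥(locAtCentre B' O₁) :=
    (mem_maximalIdeal_locAtCentre_iff hB'O₁ _).mpr ((hcen ⟨x, hx⟩).mpr (Ideal.subset_span (by simp)))
  have hym : (⟨y, hyS₁⟩ : ↥(locAtCentre B' O₁)) ∈ maximalIdeal ↥(locAtCentre B' O₁) :=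
    (mem_maximalIdeal_locAtCentre_iff hB'O₁ _).mpr ((hcen ⟨y, hy⟩).mpr (Ideal.subset_span (by simp)))
  rw [hgen] at hxm hym
  obtain ⟨l₀, l₁, hl⟩ := Ideal.mem_span_pair.mp hxm
  obtain ⟨m₀, m₁, hm⟩ := Ideal.mem_span_pair.mp hym
  have hlK : (l₀ : K) * ((x * α₀ + y * β₀) / γ₀) + (l₁ : K) * ((x * α₁ + y * β₁) / γ₁) = x := by
    have := congrArg Subtype.val hl; simpa using this
  have hmK : (m₀ : K) * ((x * α₀ + y * β₀) / γ₀) + (m₁ : K) * ((x * α₁ + y * β₁) / γ₁) = y := by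
    have := congrArg Subtype.val hm; simpa using this
  -- the matrix `P = N · M'`
  set P₀₀ : K := (l₀ : K) * (α₀ * γ₀⁻¹) + (l₁ : K) * (α₁ * γ₁⁻¹) with hP₀₀
  set P₀₁ : K := (l₀ : K) * (β₀ * γ₀⁻¹) + (l₁ : K) * (β₁ * γ₁⁻¹) with hP₀₁
  set P₁₀ : K := (m₀ : K) * (α₀ * γ₀⁻¹) + (m₁ : K) * (α₁ * γ₁⁻¹) with hP₁₀
  set P₁₁ : K := (m₀ : K) * (β₀ * γ₀⁻¹) + (m₁ : K) * (β₁ * γ₁⁻¹) with hP₁₁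
  have hP₀₀m : P₀₀ ∈ locAtCentre B' O₁ := Subring.add_mem _ (Subring.mul_mem _ l₀.2 (Subring.mul_mem _ hα₀ hγ₀inv))
    (Subring.mul_mem _ l₁.2 (Subring.mul_mem _ hα₁ hγ₁inv))
  have hP₀₁m : P₀₁ ∈ locAtCentre B' O₁ := Subring.add_mem _ (Subring.mul_mem _ l₀.2 (Subring.mul_mem _ hβ₀ hγ₀inv))
    (Subring.mul_mem _ l₁.2 (Subring.mul_mem _ hβ₁ hγ₁inv))
  have hP₁₀m : P₁₀ ∈ locAtCentre B' O₁ := Subring.add_mem _ (Subring.mul_mem _ m₀.2 (Subring.mul_mem _ hα₀ hγ₀inv))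
    (Subring.mul_mem _ m₁.2 (Subring.mul_mem _ hα₁ hγ₁inv))
  have hP₁₁m : P₁₁ ∈ locAtCentre B' O₁ := Subring.add_mem _ (Subring.mul_mem _ m₀.2 (Subring.mul_mem _ hβ₀ hγ₀inv))
    (Subring.mul_mem _ m₁.2 (Subring.mul_mem _ hβ₁ hγ₁inv))
  have hrow₀ : (1 - P₀₀) * x = P₀₁ * y := by
    have h := hlK
    rw [div_eq_mul_inv, div_eq_mul_inv] at h
    rw [hP₀₀, hP₀₁]
    linear_combination -h
  have hrow₁ : (1 - P₁₁) * y = P₁₀ * x := by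
    have h := hmK
    rw [div_eq_mul_inv, div_eq_mul_inv] at h
    rw [hP₁₁, hP₁₀]
    linear_combination -h
  -- all four of `1 - P₀₀`, `P₀₁`, `1 - P₁₁`, `P₁₀` are non-units
  have hne := fun {c : K} (hc : c ∈ locAtCentre B' O₁) => ne_mul_of_coarse hB'O hOO₁ hx hy hcen hdim₁ hc
  have hQ₀₀ : O₁.valuation (1 - P₀₀) < 1 := by
    have hmem : 1 - P₀₀ ∈ locAtCentre B' O₁ := Subring.sub_mem _ (Subring.one_mem _) hP₀₀m
    rcases (hle1 hmem).lt_or_eq with h | h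
    · exact h
    · exfalso
      have hinv : (1 - P₀₀)⁻¹ ∈ locAtCentre B' O₁ := inv_mem_locAtCentre hmem h
      refine (hne (Subring.mul_mem _ hP₀₁m hinv)).1 ?_
      have h0 : (1 - P₀₀) ≠ 0 := ne_zero_of_valuation_eq_one h
      field_simp
      linear_combination hrow₀
  have hQ₀₁ : O₁.valuation P₀₁ < 1 := by
    rcases (hle1 hP₀₁m).lt_or_eq with h | h
    · exact h
    · exfalso
      have hinv : P₀₁⁻¹ ∈ locAtCentre B' O₁ := inv_mem_locAtCentre hP₀₁m h
      refine (hne (Subring.mul_mem _ (Subring.sub_mem _ (Subring.one_mem _) hP₀₀m) hinv)).2 ?_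
      have h0 : P₀₁ ≠ 0 := ne_zero_of_valuation_eq_one h
      field_simp
      linear_combination -hrow₀
  have hQ₁₁ : O₁.valuation (1 - P₁₁) < 1 := by
    have hmem : 1 - P₁₁ ∈ locAtCentre B' O₁ := Subring.sub_mem _ (Subring.one_mem _) hP₁₁m
    rcases (hle1 hmem).lt_or_eq with h | h
    · exact h
    · exfalso
      have hinv : (1 - P₁₁)⁻¹ ∈ locAtCentre B' O₁ := inv_mem_locAtCentre hmem h
      refine (hne (Subring.mul_mem _ hP₁₀m hinv)).2 ?_
      have h0 : (1 - P₁₁) ≠ 0 := ne_zero_of_valuation_eq_one h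
      field_simp
      linear_combination hrow₁
  have hQ₁₀ : O₁.valuation P₁₀ < 1 := by
    rcases (hle1 hP₁₀m).lt_or_eq with h | h
    · exact h
    · exfalso
      have hinv : P₁₀⁻¹ ∈ locAtCentre B' O₁ := inv_mem_locAtCentre hP₁₀m h
      refine (hne (Subring.mul_mem _ (Subring.sub_mem _ (Subring.one_mem _) hP₁₁m) hinv)).1 ?_
      have h0 : P₁₀ ≠ 0 := ne_zero_of_valuation_eq_one h
      field_simp
      linear_combination -hrow₁
  -- `det P = 1 - (small)` has value `1`
  set ε : K := (1 - P₀₀) + (1 - P₁₁) - (1 - P₀₀) * (1 - P₁₁) + P₀₁ * P₁₀ with hε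
  have hεlt : O₁.valuation ε < 1 := by
    have h1 : O₁.valuation ((1 - P₀₀) + (1 - P₁₁)) < 1 := lt_of_le_of_lt (Valuation.map_add _ _ _) (max_lt hQ₀₀ hQ₁₁)
    have h2 : O₁.valuation ((1 - P₀₀) * (1 - P₁₁)) < 1 := by
      rw [map_mul]
      calc O₁.valuation (1 - P₀₀) * O₁.valuation (1 - P₁₁) ≤ O₁.valuation (1 - P₀₀) * 1 := by gcongr
        _ < 1 := by rw [mul_one]; exact hQ₀₀
    have h3 : O₁.valuation (P₀₁ * P₁₀) < 1 := by
      rw [map_mul]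
      calc O₁.valuation P₀₁ * O₁.valuation P₁₀ ≤ O₁.valuation P₀₁ * 1 := by gcongr
        _ < 1 := by rw [mul_one]; exact hQ₀₁
    have h12 : O₁.valuation ((1 - P₀₀) + (1 - P₁₁) - (1 - P₀₀) * (1 - P₁₁)) < 1 :=
      lt_of_le_of_lt (Valuation.map_sub _ _ _) (max_lt h1 h2)
    exact lt_of_le_of_lt (Valuation.map_add _ _ _) (max_lt h12 h3)
  have hdetP : O₁.valuation (P₀₀ * P₁₁ - P₀₁ * P₁₀) = 1 := by
    have : P₀₀ * P₁₁ - P₀₁ * P₁₀ = 1 + (-ε) := by rw [hε]; ring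
    rw [this, Valuation.map_add_eq_of_lt_left _ (by rw [Valuation.map_one, Valuation.map_neg]; exact hεlt), Valuation.map_one]
  -- `det P = det N · det M'`
  have hfactor : P₀₀ * P₁₁ - P₀₁ * P₁₀ = ((l₀ : K) * m₁ - l₁ * m₀) * ((α₀ * β₁ - α₁ * β₀) * (γ₀⁻¹ * γ₁⁻¹)) := by
    rw [hP₀₀, hP₀₁, hP₁₀, hP₁₁]; ring
  have hdetN : O₁.valuation ((l₀ : K) * m₁ - l₁ * m₀) ≤ 1 :=
    hle1 (Subring.sub_mem _ (Subring.mul_mem _ l₀.2 m₁.2) (Subring.mul_mem _ l₁.2 m₀.2))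
  have hdetM : O₁.valuation ((α₀ * β₁ - α₁ * β₀) * (γ₀⁻¹ * γ₁⁻¹)) ≤ 1 :=
    hle1 (Subring.mul_mem _ (Subring.sub_mem _ (Subring.mul_mem _ hα₀ hβ₁) (Subring.mul_mem _ hα₁ hβ₀)) (Subring.mul_mem _ hγ₀inv hγ₁inv))
  rw [hfactor, map_mul] at hdetP
  have h := eq_one_of_mul_eq_one_of_le hdetN hdetM hdetP
  rw [map_mul, map_mul, map_inv₀, map_inv₀, hvγ₀, hvγ₁, inv_one, mul_one, mul_one] at h
  exact h

include hB'O hcen in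
/-- **Transversality from `∉ 𝔪₁²`.**  If `(x α + y β)/γ ∈ S₁` (`α, β ∈ S'`, `v₁ γ = 1`) is NOT in `𝔪_{S₁}²`, then `v₁ α = 1` or `v₁ β = 1`. [folklore] -/
theorem transversal_of_not_mem_sq {α β γ : K} (hα : α ∈ locAtCentre B' O) (hβ : β ∈ locAtCentre B' O) (hγ : γ ∈ locAtCentre B' O₁)
    (hvγ : O₁.valuation γ = 1) (ht : (x * α + y * β) / γ ∈ locAtCentre B' O₁)
    (hnot : (⟨_, ht⟩ : ↥(locAtCentre B' O₁)) ∉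
      (haveI := isLocalRing_locAtCentre (fun _ hw => hOO₁ (hB'O hw) : B' ≤ O₁.toSubring);
        IsLocalRing.maximalIdeal ↥(locAtCentre B' O₁)) ^ 2) :
    O₁.valuation α = 1 ∨ O₁.valuation β = 1 := by
  classical
  have hB'O₁ : B' ≤ O₁.toSubring := fun _ hw => hOO₁ (hB'O hw)
  haveI := isLocalRing_locAtCentre hB'O₁
  by_contra hcon
  push Not at hcon
  obtain ⟨hvα, hvβ⟩ := hcon
  have hvα' : O₁.valuation α < 1 := lt_of_le_of_ne ((O₁.valuation_le_one_iff _).mpr (hOO₁ (locAtCentre_le hB'O hα))) hvα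
  have hvβ' : O₁.valuation β < 1 := lt_of_le_of_ne ((O₁.valuation_le_one_iff _).mpr (hOO₁ (locAtCentre_le hB'O hβ))) hvβ
  apply hnot
  have hγinv : γ⁻¹ ∈ locAtCentre B' O₁ := inv_mem_locAtCentre hγ hvγ
  have hxS₁ : x ∈ locAtCentre B' O₁ := le_locAtCentre_coarse hOO₁ hx
  have hyS₁ : y ∈ locAtCentre B' O₁ := le_locAtCentre_coarse hOO₁ hy
  have hxm : (⟨x, hxS₁⟩ : ↥(locAtCentre B' O₁)) ∈ maximalIdeal ↥(locAtCentre B' O₁) :=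
    (mem_maximalIdeal_locAtCentre_iff hB'O₁ _).mpr ((hcen ⟨x, hx⟩).mpr (Ideal.subset_span (by simp)))
  have hym : (⟨y, hyS₁⟩ : ↥(locAtCentre B' O₁)) ∈ maximalIdeal ↥(locAtCentre B' O₁) :=
    (mem_maximalIdeal_locAtCentre_iff hB'O₁ _).mpr ((hcen ⟨y, hy⟩).mpr (Ideal.subset_span (by simp)))
  have hαm : (⟨α * γ⁻¹, Subring.mul_mem _ (le_locAtCentre_coarse hOO₁ hα) hγinv⟩ : ↥(locAtCentre B' O₁)) ∈
      maximalIdeal ↥(locAtCentre B' O₁) := by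
    rw [mem_maximalIdeal_locAtCentre_iff hB'O₁]
    change O₁.valuation (α * γ⁻¹) < 1
    rw [map_mul, map_inv₀, hvγ, inv_one, mul_one]; exact hvα'
  have hβm : (⟨β * γ⁻¹, Subring.mul_mem _ (le_locAtCentre_coarse hOO₁ hβ) hγinv⟩ : ↥(locAtCentre B' O₁)) ∈
      maximalIdeal ↥(locAtCentre B' O₁) := by
    rw [mem_maximalIdeal_locAtCentre_iff hB'O₁]
    change O₁.valuation (β * γ⁻¹) < 1
    rw [map_mul, map_inv₀, hvγ, inv_one, mul_one]; exact hvβ'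
  have hsum : (⟨_, ht⟩ : ↥(locAtCentre B' O₁)) =
      ⟨x, hxS₁⟩ * ⟨α * γ⁻¹, Subring.mul_mem _ (le_locAtCentre_coarse hOO₁ hα) hγinv⟩ +
      ⟨y, hyS₁⟩ * ⟨β * γ⁻¹, Subring.mul_mem _ (le_locAtCentre_coarse hOO₁ hβ) hγinv⟩ := by
    apply Subtype.ext
    simp only [Subring.coe_add, Subring.coe_mul]
    rw [div_eq_mul_inv]; ring
  rw [hsum, pow_two]
  exact Ideal.add_mem _ (Ideal.mul_mem_mul hxm hαm) (Ideal.mul_mem_mul hym hβm)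

end setting

end Summit.ResolutionOfSingularities.ResolutionOfSingularities.Theorems.RadicialJung.CleanModels.Ccurve

end
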